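import Literature.NumberTheory.PAdicHodge.LubinTatePeriodTheta
import Literature.NumberTheory.PAdicHodge.EisensteinCoeffSurjective
import Literature.NumberTheory.PAdicHodge.LubinTateLogCoboundaries
import Literature.NumberTheory.PAdicHodge.FontaineThetaLocalField
import HarnessLib

/-!
# Hypothesis (H) holds for a totally ramified quadratic `p`-adic field

Topic `Literature/NumberTheory/PAdicHodge`; THEOREMS ONLY. Let `F/ℚ_p` be totally ramified of degree `2`
(`p ≥ 3`), `π` a uniformizer which is the root of an Eisenstein datum `D`, `χ_π` the Lubin–Tate character. We
prove the hypothesis **(H)** `LubinTateCharacterConjugateAdmissible F p hp hπ` of `LubinTateCharacterConjugates` /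
`LubinTateLogCoboundaries`: for the conjugate embedding `e ≠ id` of `F` there is `u ∈ ℂ_F`, `u ≠ 0`, with
`σ(u) = e(χ_π σ)·u` for all `σ ∈ Γ_F` — ★★ `lubinTateCharacterConjugateAdmissible_of_finrank_eq_two`.

Proof (Serre, *Abelian ℓ-adic representations* III §A.5; Colmez 1993 §I.2): with the two `ℚ_p`-embeddings `id, e`
one has `e(c)·c = N_{F/ℚ_p}(c)` (`embedding_mul_eq_norm`, Mathlib `Algebra.norm_eq_prod_embeddings`), and
`N(χ_π σ) = χ(σ)·ω(σ)⁻¹` with `ω` unramified (`LubinTateLog.omegaChar_mul_norm`). Take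
`u := Ω⁻¹·x` where `Ω = θ(t_π/t) ≠ 0` is the Lubin–Tate period (`exists_lubinTateTheta`:
`χ(σ)σ(Ω) = χ_π(σ)Ω`, valid for ALL `σ` because `𝒪_D → 𝒪_F` is onto for totally ramified `F`,
`CoeffDisc.exists_toInt_eq_lubinTateChar`) and `x ≠ 0` is a period of `ω⁻¹` (`exists_period_omegaChar`):
`σ(u) = χ(σ)χ_π(σ)⁻¹ω(σ)⁻¹·u = (N(χ_π σ)/χ_π σ)·u = e(χ_π σ)·u`.
No named facts, no `sorry`. Langlands (GL₁): this discharges (H), hence the local-algebraicity / Fontaine–Mazur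
statements for de Rham characters, for every totally ramified quadratic completion.

## References
* J.-P. Serre, *Abelian ℓ-adic representations and elliptic curves* (1968), Ch. III §A.4–A.5. [SerreAbelianLadic1968]
* P. Colmez, *Périodes des variétés abéliennes à multiplication complexe*, Ann. of Math. 138 (1993), §I.2. [Colmez1993]
* J. T. Tate, *p-divisible groups* (1967), §3.3. [Tate1967]
-/

noncomputable section

open Ideal Field WittVector ValuativeRel

namespace Literature.NumberTheory.PAdicHodge

open Literature.NumberTheory.GaloisRepresentations
open Literature.NumberTheory.GaloisRepresentations.IsNonarchimedeanLocalField
open Literature.NumberTheory.GaloisRepresentations.LubinTate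

variable {F : Type} [Field F] [ValuativeRel F] [TopologicalSpace F] [IsNonarchimedeanLocalField F] [CharZero F]
  {p : ℕ} [Fact p.Prime] (hp : valuation F p < 1)

/-! ## §1 Degree two: `e(c)·c = N(c)` -/

/-- **For `[F : ℚ_p] = 2` and `e ≠ id` the two embeddings are `id, e`, so `e(c)·c = N_{F/ℚ_p}(c)` in `F̄`.**
[cite: SerreAbelianLadic1968, Ch. III §A.5] -/
theorem embedding_mul_eq_norm (h2 : Module.finrank (PadicBase F p hp) F = 2)
    (e : F →ₐ[PadicBase F p hp] NormedAlgClosure F)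
    (he : e ≠ IsScalarTower.toAlgHom (PadicBase F p hp) F (NormedAlgClosure F)) (c : F) :
    e c * algebraMap F (NormedAlgClosure F) c =
      algebraMap (PadicBase F p hp) (NormedAlgClosure F) (Algebra.norm (PadicBase F p hp) c) := by
  classical
  rw [Algebra.norm_eq_prod_embeddings (PadicBase F p hp) (NormedAlgClosure F) c]
  have huniv : ({e, IsScalarTower.toAlgHom (PadicBase F p hp) F (NormedAlgClosure F)} :
      Finset (F →ₐ[PadicBase F p hp] NormedAlgClosure F)) = Finset.univ := by
    apply Finset.eq_univ_of_card
    rw [Finset.card_pair he, AlgHom.card (PadicBase F p hp) F (NormedAlgClosure F), h2]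
  rw [← huniv, Finset.prod_pair he, IsScalarTower.toAlgHom_apply]

/-- The same in `ℂ_F`, over the canonical `ℚ_p`-algebra structure: `ē(c)·c = ι(N_{F/ℚ_p} c)` where `ē(c)` is the image
of `e(c) ∈ F̄` in `ℂ_F` and `ι : ℚ_p → F → ℂ_F`. [cite: SerreAbelianLadic1968, Ch. III §A.5] -/
theorem coe_embedding_mul_eq_norm (h2 : Module.finrank (PadicBase F p hp) F = 2)
    (e : F →ₐ[PadicBase F p hp] NormedAlgClosure F)
    (he : e ≠ IsScalarTower.toAlgHom (PadicBase F p hp) F (NormedAlgClosure F)) (c : F) :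
    ((e c : NormedAlgClosure F) : CompletedAlgClosure F) * algebraMap F (CompletedAlgClosure F) c =
      algebraMap F (CompletedAlgClosure F) (LocalField.padicRingHom F p hp
        (letI := LocalField.padicAlgebra F p hp; Algebra.norm ℚ_[p] c)) := by
  have h := congrArg (fun y : NormedAlgClosure F => (y : CompletedAlgClosure F)) (embedding_mul_eq_norm hp h2 e he c)
  simp only [UniformSpace.Completion.coe_mul] at h
  rw [CompletedAlgClosure.algebraMap_eq_coe, h, PadicBase.algebraMap_closure_eq, ← CompletedAlgClosure.algebraMap_eq_coe]
  rfl

/-! ## §2 (H) for totally ramified quadratic `F` -/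

/-- ★★ **(H) for `F/ℚ_p` totally ramified quadratic, `p ≥ 3`.** With `u = Ω⁻¹·x` (`Ω = θ(t_π/t)` the Lubin–Tate
period, `x` a period of the unramified character `ω⁻¹ = N(χ_π)/χ`): `σ(u) = e(χ_π σ)·u` for every `σ ∈ Γ_F`.
[cite: SerreAbelianLadic1968, Ch. III §A.5 Lemma 2] [cite: Colmez1993, §I.2] [cite: Tate1967, §3.3 Thm. 2] -/
theorem lubinTateCharacterConjugateAdmissible_of_finrank_eq_two (D : EisensteinRoot F p hp) {π : 𝒪[F]}
    (hπ : (valuation F).IsUniformizer (π : F)) (hπD : (π : F) = D.root) (hk : residueFieldCard F = p) (hp3 : 3 ≤ p)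
    (h2 : Module.finrank (PadicBase F p hp) F = 2) :
    LubinTateCharacterConjugateAdmissible F p hp hπ := by
  intro M _ _ e he
  haveI : Fact (¬ IsUnit (p : integerC F)) := ⟨not_isUnit_natCast_integerC hp⟩
  haveI := isAdicComplete_integerC_natCast (F := F) hp
  have hθ : Function.Surjective (fontaineTheta (integerC F) p) := surjective_fontaineTheta_integerC hp
  have hpq : p ∣ residueFieldCard F := hk ▸ dvd_rfl
  have hq3 : 3 ≤ residueFieldCard F := hk ▸ hp3
  have hA : IsLTRing (EisensteinRoot.CoeffDisc.of D (AdjoinRoot.root D.poly)) (residueFieldCard F) := by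
    rw [hk]; simpa using D.isLTRing_coeffDisc 1
  have hf : IsLTSeries (EisensteinRoot.CoeffDisc.of D (AdjoinRoot.root D.poly)) (residueFieldCard F)
      (ltSeries (EisensteinRoot.CoeffDisc.of D (AdjoinRoot.root D.poly)) (residueFieldCard F)) :=
    isLTSeries_ltSeries _ (one_lt_residueFieldCard F)
  -- the two periods
  obtain ⟨Ω, hΩ0, hΩ⟩ := D.exists_lubinTateTheta hπ hθ hπD hpq hq3 hA hf
  obtain ⟨x, hx0, hx⟩ := LubinTateLog.exists_period_omegaChar hp hπ
  set ψ : ℚ_[p] →+* CompletedAlgClosure F := (algebraMap F (CompletedAlgClosure F)).comp (LocalField.padicRingHom F p hp)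
    with hψ
  have hX0 : PadicCompletedAlgClosure.toC hp x ≠ 0 := fun h => hx0 (by simpa using h)
  refine ⟨Ω⁻¹ * PadicCompletedAlgClosure.toC hp x, mul_ne_zero (inv_ne_zero hΩ0) hX0, fun σ _ => ?_⟩
  obtain ⟨a, ha⟩ := EisensteinRoot.CoeffDisc.exists_toInt_eq_lubinTateChar D hπD hk hπ σ
  -- names for the scalars
  set c : F := ((lubinTateChar hπ σ : 𝒪[F]) : F) with hc
  have hc0 : algebraMap F (CompletedAlgClosure F) c ≠ 0 := by
    rw [map_ne_zero]
    exact fun h => (lubinTateChar hπ σ).ne_zero (Subtype.ext h)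
  have hunit : ∀ u : ℤ_[p]ˣ, ψ (((u : ℤ_[p]) : ℚ_[p])) ≠ 0 := fun u => by
    rw [map_ne_zero, PadicInt.coe_ne_zero]; exact u.ne_zero
  have hΩσ : ψ (((GaloisRep.cyclotomicCharacter F p σ : ℤ_[p]ˣ) : ℤ_[p]) : ℚ_[p]) * (σ • Ω) =
      algebraMap F (CompletedAlgClosure F) c * Ω := hΩ σ a ha
  have hXσ : σ • PadicCompletedAlgClosure.toC hp x =
      ψ (((LubinTateLog.omegaChar hp hπ σ⁻¹ : ℤ_[p]ˣ) : ℤ_[p]) : ℚ_[p]) * PadicCompletedAlgClosure.toC hp x := by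
    rw [← PadicCompletedAlgClosure.toC_gal, hx σ, map_mul]
    rfl
  -- `ω(σ⁻¹) = ω(σ)⁻¹`, `ω(σ)·N(χ_π σ) = χ(σ)`, `e(c)·c = N(c)`
  have hωinv : ψ (((LubinTateLog.omegaChar hp hπ σ⁻¹ : ℤ_[p]ˣ) : ℤ_[p]) : ℚ_[p]) *
      ψ (((LubinTateLog.omegaChar hp hπ σ : ℤ_[p]ˣ) : ℤ_[p]) : ℚ_[p]) = 1 := by
    rw [← map_mul, ← PadicInt.coe_mul, ← Units.val_mul, ← map_mul, inv_mul_cancel, map_one, Units.val_one,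
      PadicInt.coe_one, map_one]
  have hωN : ψ (((LubinTateLog.omegaChar hp hπ σ : ℤ_[p]ˣ) : ℤ_[p]) : ℚ_[p]) *
      ψ (letI := LocalField.padicAlgebra F p hp; Algebra.norm ℚ_[p] c) =
        ψ (((GaloisRep.cyclotomicCharacter F p σ : ℤ_[p]ˣ) : ℤ_[p]) : ℚ_[p]) := by
    rw [← LubinTateLog.coe_normLubinTateCharHom hp hπ σ, ← map_mul, ← PadicInt.coe_mul, ← Units.val_mul,
      LubinTateLog.omegaChar_mul_norm]
  have hec : ((e c : NormedAlgClosure F) : CompletedAlgClosure F) * algebraMap F (CompletedAlgClosure F) c =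
      ψ (letI := LocalField.padicAlgebra F p hp; Algebra.norm ℚ_[p] c) := coe_embedding_mul_eq_norm hp h2 e he c
  have hN0 : ψ (letI := LocalField.padicAlgebra F p hp; Algebra.norm ℚ_[p] c) ≠ 0 := by
    rw [← LubinTateLog.coe_normLubinTateCharHom hp hπ σ]; exact hunit _
  -- algebra
  rw [smul_mul', smul_inv'', hXσ]
  have hω0 := hunit (LubinTateLog.omegaChar hp hπ σ)
  have hχ0 := hunit (GaloisRep.cyclotomicCharacter F p σ)
  have hσΩ : σ • Ω = (ψ (((GaloisRep.cyclotomicCharacter F p σ : ℤ_[p]ˣ) : ℤ_[p]) : ℚ_[p]))⁻¹ *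
      (algebraMap F (CompletedAlgClosure F) c * Ω) := by
    rw [eq_inv_mul_iff_mul_eq₀ hχ0]; exact hΩσ
  have hE : ((e c : NormedAlgClosure F) : CompletedAlgClosure F) =
      ψ (letI := LocalField.padicAlgebra F p hp; Algebra.norm ℚ_[p] c) * (algebraMap F (CompletedAlgClosure F) c)⁻¹ := by
    rw [eq_mul_inv_iff_mul_eq₀ hc0]; exact hec
  have hωi : ψ (((LubinTateLog.omegaChar hp hπ σ⁻¹ : ℤ_[p]ˣ) : ℤ_[p]) : ℚ_[p]) =
      (ψ (((LubinTateLog.omegaChar hp hπ σ : ℤ_[p]ˣ) : ℤ_[p]) : ℚ_[p]))⁻¹ :=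
    (inv_eq_of_mul_eq_one_left hωinv).symm
  rw [hσΩ, hE, hωi, ← hωN]
  field_simp

end Literature.NumberTheory.PAdicHodge

end
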